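import Mathlib.Analysis.Calculus.Deriv.CompMul
import Mathlib.Analysis.Calculus.Deriv.Mul
import Mathlib.Analysis.Calculus.Deriv.Pow
import Mathlib.MeasureTheory.Measure.Tilted
import Literature.MathematicalPhysics.KineticTheory.FouriersLaw
import Literature.MathematicalPhysics.KineticTheory.LangevinChainGibbs
import Literature.MathematicalPhysics.KineticTheory.NewtonianFlow
import HarnessLib

/-!
# Closed (ring) oscillator chains, the ring energy current, and the purely quartic chain

Topic `Literature/MathematicalPhysics/KineticTheory`; definition request `defn-quarticRingChain`
(route `AffineAnchor` of `AtomisticToContinuum/FouriersLaw`, item `stmt-AtomisticToContinuum-4901`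
and its siblings, which inline every object below; cards `scale-free-quartic-anchor`,
`ring-green-kubo-bypass`).

## The objects (Lepri–Livi–Politi 2003, §2.1, §2.3, §5.2)

For a chain `P : OscillatorChain` (`FouriersLaw.lean`: pinning `U`, nearest-neighbour interaction
`V`, free ends, `H = ∑ (p_i²/2 + U(q_i)) + ∑_{i<N-1} V(q_{i+1} - q_i)`), LLP §2.1: "Boundary
conditions need also to be specified … Typical choices are periodic, fixed or free boundaries."
Closing the chain into a RING adds the wrap bond `(N-1, 0)`:

* `P.ringHamiltonian N θ (q, p) = H(q, p) + θ · V(q_0 - q_{N-1})` (wrap bond only for `N ≥ 3`,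
  so that no bond is doubled and no self-bond appears; `θ = 0`: free ends, `θ = 1`: the ring,
  general `θ`: wrap bond of strength `θ`, the interpolation used by the requesting route);
* `P.ringForce N θ q i = -∂_{q_i} H_θ (q, 0)`, the force field of Newton's equations
  `q̇ = p, ṗ = -∇_q H_θ` in the format of `NewtonianFlow.IsFlow` (`NewtonianFlow.lean`);
* `P.ringGibbsMeasure N θ T = Z⁻¹ e^{-H_θ/T} dq dp` (Mathlib `Measure.tilted`, the convention of
  `OscillatorChain.gibbsMeasure` in `LangevinChainGibbs.lean`);
* `P.ringCurrent N θ (q, p) = ∑_{i<N-1} j_i + j_wrap`, the TOTAL heat flux `J = ∑_n j_n` of LLP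
  §2.3 (local flux `j_n = -½ (p_n + p_{n+1}) V'(q_{n+1} - q_n)`, `OscillatorChain.bondCurrent`,
  BLR 2000 eq. (23)) including the wrap bond with potential `θ V`;
* `P.currentAutocorrelation N θ T Φ t = ∫ J(Φ_t x) J(x) dμ_{θ,T}(x)`, the equilibrium current
  autocorrelation `⟨J(t) J(0)⟩` entering the Green–Kubo formula
  `κ_GK = (k_B T²)⁻¹ lim_{t→∞} ∫₀ᵗ dτ lim_N N⁻¹ ⟨J(τ)J(0)⟩` (LLP §5.2), for a given flow `Φ` of the
  ring (a hypothesis of the statements that use it, as in the requesting route);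
* `pureQuarticChain μ γ = ⟨U = μ q⁴/4, V = r⁴/4, γ⟩`, the doubly homogeneous quartic chain
  (quartic pinning AND quartic coupling, no harmonic part): the scale-free member of the
  `FouriersLaw` family, with the quartic similarity `quarticDilation a (q, p) = (a q, a² p)` under
  which `H ∘ S_a = a⁴ H`, `J ∘ S_a = a⁵ J`, `F(a q) = a³ F(q)` (mechanical similarity for a potential
  homogeneous of degree `4`, Landau–Lifshitz *Mechanics* §10).

## API (all proved, [folklore] unless cited)

* wrap sums collapse: `sum_sum_wrap_eq`; closed forms `ringHamiltonian_eq_dite`,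
  `ringCurrent_eq_dite`; no wrap for `N ≤ 2` (`ringHamiltonian_of_le_two`, `ringCurrent_of_le_two`);
* `θ = 0` is the free chain: `ringHamiltonian_zero_wrap`, `ringCurrent_zero_wrap`
  (`= ∑ i, bondCurrent`, the integrand of `OscillatorChain.totalCurrent`), `ringGibbsMeasure_zero_wrap`
  (`= gibbsMeasure`), `currentAutocorrelation_zero_wrap`; `ringForce_eq` (the inline form with
  `(q, fun _ => 0)`); `hamiltonian_le_ringHamiltonian` (`θ ≥ 0`, `V ≥ 0`);
* parity under momentum reversal `Π(q,p) = (q,-p)`: `ringHamiltonian_neg_momentum` (even),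
  `ringCurrent_neg_momentum` (odd), hence `integral_ringCurrent_ringGibbsMeasure = 0`;
* Gibbs: `ringGibbsMeasure_absolutelyContinuous`, `isProbabilityMeasure_ringGibbsMeasure`,
  `currentAutocorrelation_eq_of_apply_eq` (`C = ∫ J²` at a time where `Φ_t = id`);
* the purely quartic chain: `pureQuarticChain_eq_mk` (`rfl` with the inline anonymous
  constructor), `_U/_V/_γ`, `deriv`s, smoothness, the inline forms of its ring Hamiltonian and ring
  current (`pureQuarticChain_ringHamiltonian_eq`, `pureQuarticChain_ringCurrent_eq`), and the
  homogeneity identities `pureQuarticChain_hamiltonian_quarticDilation` (`a⁴`),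
  `pureQuarticChain_ringHamiltonian_quarticDilation` (`a⁴`), `pureQuarticChain_bondCurrent_quarticDilation`
  (`a⁵`), `pureQuarticChain_ringCurrent_quarticDilation` (`a⁵`), `pureQuarticChain_ringForce_smul`
  (`a³`, `a ≠ 0`), via the chain rule `partialQ_comp_quarticDilation`;
* similarity of flows: `isFlow_conj_quarticDilation` — a Newtonian flow `Φ` (`NewtonianFlow.IsFlow`)
  of a force homogeneous of degree `3` gives the flow `(t, x) ↦ S_a (Φ_{a t} (S_{a⁻¹} x))` of the
  same force (`a ≠ 0`), specialised to the purely quartic ring in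
  `isFlow_pureQuarticChain_conj_quarticDilation` (for a flow unique in its class:
  `Φ_t ∘ S_a = S_a ∘ Φ_{a t}`; uniqueness for the cubic, non-Lipschitz force is not proved here).

## Design choices

* NAME. The requested name `quarticChain` is taken in this namespace by the quartic PROFILE chain
  on `ℤ` (`quarticChain ω₂ lam β : InfiniteChain`, `HarmonicHostWithCell.lean`, harmonic + quartic
  with site-dependent couplings); the finite homogeneous chain with no harmonic part is therefore
  `pureQuarticChain μ γ` ("purely quartic lattice"). It is NOT a member of `pinnedChain ω₂ lam β γ`
  (whose coupling always contains `r²/2`); the conjugacy to `pinnedChain` at high temperature is a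
  route statement, not vendored here.
* The bodies are LITERALLY the inline forms of the requesting Theses file (double sums over
  `i j : Fin N` with the indicator `i.val + 1 = N ∧ j.val = 0 ∧ 2 < N`, wrap current with
  `deriv (fun r => θ * P.V r)`, force at `(q, 0)`), so that the items restate `1:1` by `rfl`;
  the human-readable closed forms are the `_eq_dite` lemmas.
* `ringForce` differentiates `H_θ` along `q_i` at momentum `0` (`∂_{q_i}H_θ` does not depend on
  `p`); for non-differentiable potentials `partialQ` is a junk `0`, as everywhere in this topic.
* `ringGibbsMeasure` is Mathlib's tilted Lebesgue measure: the probability measure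
  `e^{-H_θ/T} dq dp / Z` when `e^{-H_θ/T}` is integrable (e.g. `pureQuarticChain μ γ`, `μ > 0`,
  `θ ≥ 0`, `T > 0` — integrability itself is a route support item, not proved here), the ZERO
  measure otherwise (`T ≤ 0`, or `θ < 0` with unbounded-below wrap energy); then
  `currentAutocorrelation` is `0`. `currentAutocorrelation` is a Bochner integral (junk `0` for a
  non-integrable integrand) and takes the flow `Φ` as data: existence/uniqueness of the Newtonian
  flow of `H_θ`, Liouville, `J ∈ L²`, and every spectral/transport statement are route items.
* Not here: existence/uniqueness of the ring flow (hence the equality `Φ_t ∘ S_a = S_a ∘ Φ_{at}`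
  itself), continuity/integrability (`L²`) estimates of `H_θ`, `J`, the thermostatted (open) ring.
-/

noncomputable section

open MeasureTheory

namespace Literature.MathematicalPhysics.KineticTheory.HeatConduction

variable {N : ℕ}

/-! ### Wrap-bond sums -/

/-- The double sum with the wrap-bond indicator `i = N-1 ∧ j = 0 ∧ 2 < N` has exactly one term,
`g (N-1) 0`, when `N ≥ 3`, and vanishes for `N ≤ 2`. [folklore] -/
theorem sum_sum_wrap_eq (N : ℕ) (g : Fin N → Fin N → ℝ) :
    (∑ i : Fin N, ∑ j : Fin N, if i.val + 1 = N ∧ j.val = 0 ∧ 2 < N then g i j else 0) =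
      if h : 2 < N then g ⟨N - 1, by omega⟩ ⟨0, by omega⟩ else 0 := by
  by_cases h : 2 < N
  · rw [dif_pos h,
      Finset.sum_eq_single_of_mem (⟨N - 1, by omega⟩ : Fin N) (Finset.mem_univ _)]
    · rw [Finset.sum_eq_single_of_mem (⟨0, by omega⟩ : Fin N) (Finset.mem_univ _)]
      · have h1 : N - 1 + 1 = N := by omega
        simp [h1, h]
      · intro j _ hj
        have hj0 : j.val ≠ 0 := fun h0 => hj (Fin.ext h0)
        simp [hj0]
    · intro i _ hi
      have hi0 : i.val + 1 ≠ N := fun h0 => hi (Fin.ext (show i.val = N - 1 by omega))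
      simp [hi0]
  · rw [dif_neg h]
    simp [h]

/-! ### The purely quartic chain -/

/-- The **purely quartic chain**: unit masses, homogeneous quartic pinning `U(q) = μ q⁴/4` and
homogeneous quartic nearest-neighbour coupling `V(r) = r⁴/4` (no harmonic parts), Langevin bath
coupling `γ`; an optical model in the class of Lepri–Livi–Politi 2003 §2.1
(`H = ∑ [p_l²/2 + U(x_l) + V(x_{l+1} - x_l)]`) whose Hamiltonian is homogeneous of degree `4`
under `(q, p) ↦ (a q, a² p)`. [Lepri–Livi–Politi 2003, §2.1] [folklore] -/
def pureQuarticChain (μ γ : ℝ) : OscillatorChain where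
  U q := μ * q ^ 4 / 4
  V r := r ^ 4 / 4
  γ := γ

/-- `pureQuarticChain μ γ` is the anonymous-constructor chain inlined by the requesting route.
[folklore] -/
theorem pureQuarticChain_eq_mk (μ γ : ℝ) :
    pureQuarticChain μ γ = OscillatorChain.mk (fun q => μ * q ^ 4 / 4) (fun r => r ^ 4 / 4) γ :=
  rfl

/-- Pinning of the purely quartic chain. [folklore] -/
@[simp] theorem pureQuarticChain_U (μ γ q : ℝ) : (pureQuarticChain μ γ).U q = μ * q ^ 4 / 4 := rfl

/-- Coupling of the purely quartic chain. [folklore] -/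
@[simp] theorem pureQuarticChain_V (μ γ r : ℝ) : (pureQuarticChain μ γ).V r = r ^ 4 / 4 := rfl

/-- Bath coupling of the purely quartic chain. [folklore] -/
@[simp] theorem pureQuarticChain_γ (μ γ : ℝ) : (pureQuarticChain μ γ).γ = γ := rfl

/-- `V'(r) = r³`. [folklore] -/
theorem pureQuarticChain_hasDerivAt_V (μ γ r : ℝ) :
    HasDerivAt (pureQuarticChain μ γ).V (r ^ 3) r := by
  have h := (hasDerivAt_pow 4 r).div_const 4
  refine (h.congr_deriv ?_).congr_of_eventuallyEq (Filter.Eventually.of_forall fun s => rfl)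
  ring

/-- `V'(r) = r³`. [folklore] -/
@[simp] theorem pureQuarticChain_deriv_V (μ γ r : ℝ) :
    deriv (pureQuarticChain μ γ).V r = r ^ 3 :=
  (pureQuarticChain_hasDerivAt_V μ γ r).deriv

/-- `U'(q) = μ q³`. [folklore] -/
theorem pureQuarticChain_hasDerivAt_U (μ γ q : ℝ) :
    HasDerivAt (pureQuarticChain μ γ).U (μ * q ^ 3) q := by
  have h := ((hasDerivAt_pow 4 q).const_mul μ).div_const 4
  refine (h.congr_deriv ?_).congr_of_eventuallyEq (Filter.Eventually.of_forall fun s => ?_)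
  · push_cast; ring
  · simp [pureQuarticChain, mul_div_assoc]

/-- `U'(q) = μ q³`. [folklore] -/
@[simp] theorem pureQuarticChain_deriv_U (μ γ q : ℝ) :
    deriv (pureQuarticChain μ γ).U q = μ * q ^ 3 :=
  (pureQuarticChain_hasDerivAt_U μ γ q).deriv

/-- The potentials of the purely quartic chain are smooth. [folklore] -/
theorem pureQuarticChain_contDiff_U (μ γ : ℝ) {n : WithTop ℕ∞} :
    ContDiff ℝ n (pureQuarticChain μ γ).U := by
  change ContDiff ℝ n fun q : ℝ => μ * q ^ 4 / 4
  fun_prop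

/-- The potentials of the purely quartic chain are smooth. [folklore] -/
theorem pureQuarticChain_contDiff_V (μ γ : ℝ) {n : WithTop ℕ∞} :
    ContDiff ℝ n (pureQuarticChain μ γ).V := by
  change ContDiff ℝ n fun r : ℝ => r ^ 4 / 4
  fun_prop

/-- `U ≥ 0` for `μ ≥ 0`. [folklore] -/
theorem pureQuarticChain_U_nonneg {μ : ℝ} (hμ : 0 ≤ μ) (γ q : ℝ) :
    0 ≤ (pureQuarticChain μ γ).U q := by
  simp only [pureQuarticChain_U]
  positivity

/-- `V ≥ 0`. [folklore] -/
theorem pureQuarticChain_V_nonneg (μ γ r : ℝ) : 0 ≤ (pureQuarticChain μ γ).V r := by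
  simp only [pureQuarticChain_V]
  positivity

/-! ### The quartic similarity `S_a (q, p) = (a q, a² p)` -/

/-- The quartic similarity transformation `S_a(q, p) = (a q, a² p)` of phase space: for a
potential energy homogeneous of degree `4`, lengths scale by `a`, times by `a⁻¹`, hence momenta
by `a²` and energies by `a⁴` (mechanical similarity). [cite: LandauLifshitzMechanics1976, §10] -/
def quarticDilation (a : ℝ) (x : PhaseSpace N) : PhaseSpace N :=
  (a • x.1, a ^ 2 • x.2)

/-- Positions scale by `a`. [folklore] -/
@[simp] theorem quarticDilation_fst (a : ℝ) (x : PhaseSpace N) :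
    (quarticDilation a x).1 = a • x.1 := rfl

/-- Momenta scale by `a²`. [folklore] -/
@[simp] theorem quarticDilation_snd (a : ℝ) (x : PhaseSpace N) :
    (quarticDilation a x).2 = a ^ 2 • x.2 := rfl

/-- `S_1 = id`. [folklore] -/
@[simp] theorem quarticDilation_one (x : PhaseSpace N) : quarticDilation 1 x = x := by
  simp [quarticDilation]

/-- `S_{ab} = S_a ∘ S_b` (an action of the multiplicative monoid of `ℝ`). [folklore] -/
theorem quarticDilation_mul (a b : ℝ) (x : PhaseSpace N) :
    quarticDilation (a * b) x = quarticDilation a (quarticDilation b x) := by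
  simp only [quarticDilation, mul_pow, mul_smul]

/-- Chain rule for the position-coordinate derivative under `S_a`:
`∂_{q_i}(f ∘ S_a) = a · (∂_{q_i} f) ∘ S_a` (both sides are junk `0` together). [folklore] -/
theorem partialQ_comp_quarticDilation (a : ℝ) (i : Fin N) (f : PhaseSpace N → ℝ)
    (x : PhaseSpace N) :
    partialQ i (fun y => f (quarticDilation a y)) x = a * partialQ i f (quarticDilation a x) := by
  show deriv (fun t => f (a • Function.update x.1 i t, a ^ 2 • x.2)) (x.1 i) =
    a * deriv (fun t => f (Function.update (a • x.1) i t, a ^ 2 • x.2)) ((a • x.1) i)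
  set g : ℝ → ℝ := fun u => f (Function.update (a • x.1) i u, a ^ 2 • x.2) with hg
  have h : (fun t : ℝ => f (a • Function.update x.1 i t, a ^ 2 • x.2)) = fun t => g (a * t) := by
    funext t
    simp only [hg]
    rw [← smul_eq_mul a t, Function.update_smul]
  rw [h, deriv_comp_mul_left, smul_eq_mul]
  rfl

/-- `∂_{q_i}` is linear: `∂_{q_i}(c f) = c ∂_{q_i} f`. [folklore] -/
theorem partialQ_const_mul_eq (c : ℝ) (i : Fin N) (f : PhaseSpace N → ℝ) (x : PhaseSpace N) :
    partialQ i (fun y => c * f y) x = c * partialQ i f x := by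
  unfold partialQ
  exact deriv_const_mul_field c

namespace OscillatorChain

variable (P : OscillatorChain)

/-! ### The ring: Hamiltonian, force, Gibbs measure, current, current autocorrelation -/

/-- The **ring Hamiltonian with wrap strength `θ`**:
`H_θ(q, p) = H(q, p) + θ · V(q_0 - q_{N-1})`, i.e. the free-end Hamiltonian
`OscillatorChain.hamiltonian` plus the wrap bond `(N-1, 0)` (present only for `N ≥ 3`), written as
the double sum over `i j : Fin N` with the indicator `i = N-1 ∧ j = 0 ∧ 2 < N`; `θ = 0`: free
boundary conditions, `θ = 1`: periodic boundary conditions (the ring).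
[Lepri–Livi–Politi 2003, §2.1 ("Typical choices are periodic, fixed or free boundaries")]
[cite: LepriLiviPoliti2003, §2.1] -/
def ringHamiltonian (N : ℕ) (θ : ℝ) (x : PhaseSpace N) : ℝ :=
  P.hamiltonian N x +
    θ * ∑ i : Fin N, ∑ j : Fin N,
      if i.val + 1 = N ∧ j.val = 0 ∧ 2 < N then P.V (x.1 j - x.1 i) else 0

/-- The **force field of the ring**, `F_i(q) = -∂_{q_i} H_θ(q, 0)`, in the format of
`NewtonianFlow.IsFlow` (Newton's equations `q̇ = p`, `ṗ = F(q)`; `∂_{q_i} H_θ` is independent of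
`p`, evaluated at `p = 0`). [folklore] -/
def ringForce (N : ℕ) (θ : ℝ) (q : Fin N → ℝ) (i : Fin N) : ℝ :=
  -partialQ i (P.ringHamiltonian N θ) (q, 0)

/-- The **Gibbs measure of the ring** at temperature `T`: Lebesgue measure on phase space tilted by
`-H_θ/T`, i.e. `Z⁻¹ e^{-H_θ/T} dq dp` when `e^{-H_θ/T}` is integrable and the zero measure
otherwise (Mathlib `Measure.tilted`, as `OscillatorChain.gibbsMeasure`). [folklore] -/
def ringGibbsMeasure (N : ℕ) (θ T : ℝ) : Measure (PhaseSpace N) :=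
  (volume : Measure (PhaseSpace N)).tilted fun x => -P.ringHamiltonian N θ x / T

/-- The **total heat flux of the ring**, `J = ∑_n j_n` (Lepri–Livi–Politi 2003 §2.3) with the
local flux `j_n = -½ (p_n + p_{n+1}) V'(q_{n+1} - q_n)` of `OscillatorChain.bondCurrent`
(Bonetto–Lebowitz–Rey-Bellet 2000 eq. (23)): the free-end bonds plus the wrap bond `(N-1, 0)`
(for `N ≥ 3`) whose potential is `θ V`. [cite: LepriLiviPoliti2003, §2.3] -/
def ringCurrent (N : ℕ) (θ : ℝ) (x : PhaseSpace N) : ℝ :=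
  (∑ i, P.bondCurrent N i x) +
    ∑ i : Fin N, ∑ j : Fin N,
      if i.val + 1 = N ∧ j.val = 0 ∧ 2 < N then
        -((x.2 i + x.2 j) / 2 * deriv (fun r => θ * P.V r) (x.1 j - x.1 i)) else 0

/-- The **equilibrium current autocorrelation** `C_N(t) = ⟨J(Φ_t ·) J⟩_{θ,T} =
∫ J(Φ_t x) J(x) dμ_{θ,T}(x)` of the ring at temperature `T`, for a given flow `Φ` of the ring
dynamics — the integrand of the Green–Kubo formula
`κ_GK = (k_B T²)⁻¹ lim_{t→∞} ∫₀ᵗ dτ lim_N N⁻¹ ⟨J(τ) J(0)⟩`. A Bochner integral (junk `0` when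
not integrable or when the Gibbs measure is the zero measure).
[Lepri–Livi–Politi 2003, §5.2] [cite: LepriLiviPoliti2003, §5.2] -/
def currentAutocorrelation (N : ℕ) (θ T : ℝ) (Φ : ℝ → PhaseSpace N → PhaseSpace N) (t : ℝ) : ℝ :=
  ∫ x, P.ringCurrent N θ (Φ t x) * P.ringCurrent N θ x ∂(P.ringGibbsMeasure N θ T)

/-! ### Closed forms and the free-end case -/

/-- Closed form of the ring Hamiltonian: `H_θ = H + θ V(q_0 - q_{N-1})` for `N ≥ 3`, `H_θ = H`
for `N ≤ 2`. [folklore] -/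
theorem ringHamiltonian_eq_dite (N : ℕ) (θ : ℝ) (x : PhaseSpace N) :
    P.ringHamiltonian N θ x = P.hamiltonian N x +
      θ * (if h : 2 < N then P.V (x.1 ⟨0, by omega⟩ - x.1 ⟨N - 1, by omega⟩) else 0) := by
  rw [ringHamiltonian, sum_sum_wrap_eq]

/-- The ring Hamiltonian for `N ≥ 3`. [folklore] -/
theorem ringHamiltonian_of_two_lt {N : ℕ} (h : 2 < N) (θ : ℝ) (x : PhaseSpace N) :
    P.ringHamiltonian N θ x =
      P.hamiltonian N x + θ * P.V (x.1 ⟨0, by omega⟩ - x.1 ⟨N - 1, by omega⟩) := by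
  rw [ringHamiltonian_eq_dite, dif_pos h]

/-- No wrap bond for `N ≤ 2`. [folklore] -/
theorem ringHamiltonian_of_le_two {N : ℕ} (h : N ≤ 2) (θ : ℝ) :
    P.ringHamiltonian N θ = P.hamiltonian N := by
  funext x
  rw [ringHamiltonian_eq_dite, dif_neg (by omega), mul_zero, add_zero]

/-- Wrap strength `0` is the free chain: `H_0 = H`. [folklore] -/
@[simp] theorem ringHamiltonian_zero_wrap (N : ℕ) : P.ringHamiltonian N 0 = P.hamiltonian N := by
  funext x
  rw [ringHamiltonian, zero_mul, add_zero]

/-- The wrap bond can only raise the energy when `θ ≥ 0` and `V ≥ 0`: `H ≤ H_θ`. [folklore] -/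
theorem hamiltonian_le_ringHamiltonian {θ : ℝ} (hθ : 0 ≤ θ) (hV : ∀ r, 0 ≤ P.V r) (N : ℕ)
    (x : PhaseSpace N) : P.hamiltonian N x ≤ P.ringHamiltonian N θ x := by
  rw [ringHamiltonian]
  refine le_add_of_nonneg_right (mul_nonneg hθ ?_)
  refine Finset.sum_nonneg fun i _ => Finset.sum_nonneg fun j _ => ?_
  split_ifs
  · exact hV _
  · exact le_rfl

/-- The ring force is the inline force field `fun q i => -∂_{q_i} H_θ (q, fun _ => 0)` of the
requesting route. [folklore] -/
theorem ringForce_eq (N : ℕ) (θ : ℝ) :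
    P.ringForce N θ = fun q i => -partialQ i (P.ringHamiltonian N θ) (q, fun _ => 0) := rfl

/-- The wrap current with the derivative taken out: `(θ V)' = θ V'` (no differentiability
needed). [folklore] -/
theorem ringCurrent_eq (N : ℕ) (θ : ℝ) (x : PhaseSpace N) :
    P.ringCurrent N θ x = (∑ i, P.bondCurrent N i x) +
      θ * ∑ i : Fin N, ∑ j : Fin N,
        if i.val + 1 = N ∧ j.val = 0 ∧ 2 < N then
          -((x.2 i + x.2 j) / 2 * deriv P.V (x.1 j - x.1 i)) else 0 := by
  rw [ringCurrent]
  simp only [deriv_const_mul_field']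
  congr 1
  rw [Finset.mul_sum]
  refine Finset.sum_congr rfl fun i _ => ?_
  rw [Finset.mul_sum]
  refine Finset.sum_congr rfl fun j _ => ?_
  split_ifs <;> ring

/-- Closed form of the ring current: `J = ∑_{i<N-1} j_i - θ ½ (p_{N-1} + p_0) V'(q_0 - q_{N-1})`
for `N ≥ 3`, `J = ∑ j_i` for `N ≤ 2`. [folklore] -/
theorem ringCurrent_eq_dite (N : ℕ) (θ : ℝ) (x : PhaseSpace N) :
    P.ringCurrent N θ x = (∑ i, P.bondCurrent N i x) +
      θ * (if h : 2 < N then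
        -((x.2 ⟨N - 1, by omega⟩ + x.2 ⟨0, by omega⟩) / 2 *
          deriv P.V (x.1 ⟨0, by omega⟩ - x.1 ⟨N - 1, by omega⟩)) else 0) := by
  rw [ringCurrent_eq, sum_sum_wrap_eq]

/-- No wrap current for `N ≤ 2`. [folklore] -/
theorem ringCurrent_of_le_two {N : ℕ} (h : N ≤ 2) (θ : ℝ) (x : PhaseSpace N) :
    P.ringCurrent N θ x = ∑ i, P.bondCurrent N i x := by
  rw [ringCurrent_eq_dite, dif_neg (by omega), mul_zero, add_zero]

/-- Wrap strength `0`: the ring current is the space-summed free-end current `∑ i, j_i`, the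
integrand of `OscillatorChain.totalCurrent`. [folklore] -/
@[simp] theorem ringCurrent_zero_wrap (N : ℕ) (x : PhaseSpace N) :
    P.ringCurrent N 0 x = ∑ i, P.bondCurrent N i x := by
  rw [ringCurrent_eq, zero_mul, add_zero]

/-- Unfolding the ring Gibbs measure. [folklore] -/
theorem ringGibbsMeasure_eq (N : ℕ) (θ T : ℝ) :
    P.ringGibbsMeasure N θ T =
      (volume : Measure (PhaseSpace N)).tilted fun x => -P.ringHamiltonian N θ x / T := rfl

/-- Wrap strength `0`: the ring Gibbs measure is the Gibbs measure of the free chain. [folklore] -/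
@[simp] theorem ringGibbsMeasure_zero_wrap (N : ℕ) (T : ℝ) :
    P.ringGibbsMeasure N 0 T = P.gibbsMeasure N T := by
  rw [ringGibbsMeasure, ringHamiltonian_zero_wrap]
  rfl

/-- The ring Gibbs measure is absolutely continuous with respect to Lebesgue measure. [folklore] -/
theorem ringGibbsMeasure_absolutelyContinuous (N : ℕ) (θ T : ℝ) :
    P.ringGibbsMeasure N θ T ≪ volume :=
  tilted_absolutelyContinuous _ _

/-- If `e^{-H_θ/T}` is Lebesgue integrable the ring Gibbs measure is a probability measure.
[folklore] -/
theorem isProbabilityMeasure_ringGibbsMeasure {N : ℕ} {θ T : ℝ}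
    (h : Integrable fun x => Real.exp (-P.ringHamiltonian N θ x / T)) :
    IsProbabilityMeasure (P.ringGibbsMeasure N θ T) :=
  isProbabilityMeasure_tilted h

/-- If `e^{-H_θ/T}` is not integrable the ring Gibbs measure is the zero measure. [folklore] -/
theorem ringGibbsMeasure_of_not_integrable {N : ℕ} {θ T : ℝ}
    (h : ¬ Integrable fun x => Real.exp (-P.ringHamiltonian N θ x / T)) :
    P.ringGibbsMeasure N θ T = 0 :=
  tilted_of_not_integrable h

/-- Wrap strength `0`: the current autocorrelation of the free chain in its Gibbs state.
[folklore] -/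
theorem currentAutocorrelation_zero_wrap (N : ℕ) (T : ℝ) (Φ : ℝ → PhaseSpace N → PhaseSpace N)
    (t : ℝ) : P.currentAutocorrelation N 0 T Φ t =
      ∫ x, (∑ i, P.bondCurrent N i (Φ t x)) * ∑ i, P.bondCurrent N i x ∂(P.gibbsMeasure N T) := by
  simp [currentAutocorrelation]

/-- At a time where the flow map is the identity (e.g. `t = 0`), `C_N = ∫ J² dμ_{θ,T}`.
[folklore] -/
theorem currentAutocorrelation_eq_of_apply_eq {N : ℕ} (θ T : ℝ)
    {Φ : ℝ → PhaseSpace N → PhaseSpace N} {t : ℝ} (h : ∀ x, Φ t x = x) :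
    P.currentAutocorrelation N θ T Φ t = ∫ x, P.ringCurrent N θ x ^ 2 ∂(P.ringGibbsMeasure N θ T) := by
  simp [currentAutocorrelation, h, sq]

/-! ### Parity under momentum reversal -/

/-- The ring Hamiltonian is even in the momenta. [folklore] -/
theorem ringHamiltonian_neg_momentum (N : ℕ) (θ : ℝ) (x : PhaseSpace N) :
    P.ringHamiltonian N θ (x.1, -x.2) = P.ringHamiltonian N θ x := by
  simp only [ringHamiltonian, OscillatorChain.hamiltonian_neg_momentum]

/-- The ring current is odd in the momenta. [folklore] -/
theorem ringCurrent_neg_momentum (N : ℕ) (θ : ℝ) (x : PhaseSpace N) :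
    P.ringCurrent N θ (x.1, -x.2) = -P.ringCurrent N θ x := by
  have h1 : ∑ i, P.bondCurrent N i (x.1, -x.2) = -∑ i, P.bondCurrent N i x := by
    rw [← Finset.sum_neg_distrib]
    exact Finset.sum_congr rfl fun i _ => P.bondCurrent_neg_momentum N i x
  rw [ringCurrent_eq_dite, ringCurrent_eq_dite, h1]
  simp only [Pi.neg_apply]
  split_ifs <;> ring

/-- **No mean current in the ring Gibbs state**: `∫ J dμ_{θ,T} = 0` (the current is odd and the
Gibbs weight even under the Lebesgue-preserving momentum reversal; for a non-integrable weight
both sides are `0`). [folklore] -/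
theorem integral_ringCurrent_ringGibbsMeasure (N : ℕ) (θ T : ℝ) :
    ∫ x, P.ringCurrent N θ x ∂(P.ringGibbsMeasure N θ T) = 0 := by
  rw [ringGibbsMeasure, integral_tilted]
  have h := integral_comp_momentumReversal N fun x =>
    (Real.exp (-P.ringHamiltonian N θ x / T) /
        ∫ y, Real.exp (-P.ringHamiltonian N θ y / T)) • P.ringCurrent N θ x
  simp only [ringHamiltonian_neg_momentum, ringCurrent_neg_momentum, smul_neg, integral_neg] at h
  linarith

end OscillatorChain

/-! ### The purely quartic ring: inline forms and homogeneity -/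

/-- The ring Hamiltonian of the purely quartic chain is the inline `H_θ` of the requesting route
(`rfl`). [folklore] -/
theorem pureQuarticChain_ringHamiltonian_eq (μ γ θ : ℝ) (N : ℕ) (x : PhaseSpace N) :
    (pureQuarticChain μ γ).ringHamiltonian N θ x = (pureQuarticChain μ γ).hamiltonian N x +
      θ * ∑ i : Fin N, ∑ j : Fin N,
        if i.val + 1 = N ∧ j.val = 0 ∧ 2 < N then (x.1 j - x.1 i) ^ 4 / 4 else 0 := rfl

/-- The ring current of the purely quartic chain is the inline `J_N` of the requesting route (wrap
term `-½ (p_i + p_j) · θ (q_j - q_i)³`). [folklore] -/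
theorem pureQuarticChain_ringCurrent_eq (μ γ θ : ℝ) (N : ℕ) (x : PhaseSpace N) :
    (pureQuarticChain μ γ).ringCurrent N θ x = (∑ i, (pureQuarticChain μ γ).bondCurrent N i x) +
      ∑ i : Fin N, ∑ j : Fin N,
        if i.val + 1 = N ∧ j.val = 0 ∧ 2 < N then
          -((x.2 i + x.2 j) / 2 * (θ * (x.1 j - x.1 i) ^ 3)) else 0 := by
  rw [OscillatorChain.ringCurrent]
  simp only [deriv_const_mul_field', pureQuarticChain_deriv_V]

/-- **Mechanical similarity, energy**: `H(a q, a² p) = a⁴ H(q, p)` for the purely quartic chain.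
[cite: LandauLifshitzMechanics1976, §10] -/
theorem pureQuarticChain_hamiltonian_quarticDilation (μ γ a : ℝ) (N : ℕ) (x : PhaseSpace N) :
    (pureQuarticChain μ γ).hamiltonian N (quarticDilation a x) =
      a ^ 4 * (pureQuarticChain μ γ).hamiltonian N x := by
  simp only [OscillatorChain.hamiltonian, pureQuarticChain, quarticDilation, Pi.smul_apply,
    smul_eq_mul]
  rw [mul_add, Finset.mul_sum, Finset.mul_sum]
  congr 1
  · exact Finset.sum_congr rfl fun i _ => by ring
  · refine Finset.sum_congr rfl fun i _ => ?_
    rw [Finset.mul_sum]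
    refine Finset.sum_congr rfl fun j _ => ?_
    split_ifs <;> ring

/-- **Mechanical similarity, ring energy**: `H_θ(a q, a² p) = a⁴ H_θ(q, p)`.
[cite: LandauLifshitzMechanics1976, §10] -/
theorem pureQuarticChain_ringHamiltonian_quarticDilation (μ γ θ a : ℝ) (N : ℕ)
    (x : PhaseSpace N) :
    (pureQuarticChain μ γ).ringHamiltonian N θ (quarticDilation a x) =
      a ^ 4 * (pureQuarticChain μ γ).ringHamiltonian N θ x := by
  rw [pureQuarticChain_ringHamiltonian_eq, pureQuarticChain_ringHamiltonian_eq,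
    pureQuarticChain_hamiltonian_quarticDilation, mul_add, quarticDilation_fst,
    mul_left_comm (a ^ 4) θ]
  congr 2
  rw [Finset.mul_sum]
  refine Finset.sum_congr rfl fun i _ => ?_
  rw [Finset.mul_sum]
  refine Finset.sum_congr rfl fun j _ => ?_
  simp only [Pi.smul_apply, smul_eq_mul]
  split_ifs <;> ring

/-- **Mechanical similarity, bond currents**: `j_i(a q, a² p) = a⁵ j_i(q, p)` (an energy `a⁴`
per time `a⁻¹`). [cite: LandauLifshitzMechanics1976, §10] -/
theorem pureQuarticChain_bondCurrent_quarticDilation (μ γ a : ℝ) (N : ℕ) (i : Fin N)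
    (x : PhaseSpace N) :
    (pureQuarticChain μ γ).bondCurrent N i (quarticDilation a x) =
      a ^ 5 * (pureQuarticChain μ γ).bondCurrent N i x := by
  simp only [OscillatorChain.bondCurrent, pureQuarticChain_deriv_V, quarticDilation, Pi.smul_apply,
    smul_eq_mul]
  rw [Finset.mul_sum]
  refine Finset.sum_congr rfl fun j _ => ?_
  split_ifs <;> ring

/-- **Mechanical similarity, ring current**: `J(a q, a² p) = a⁵ J(q, p)`.
[cite: LandauLifshitzMechanics1976, §10] -/
theorem pureQuarticChain_ringCurrent_quarticDilation (μ γ θ a : ℝ) (N : ℕ) (x : PhaseSpace N) :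
    (pureQuarticChain μ γ).ringCurrent N θ (quarticDilation a x) =
      a ^ 5 * (pureQuarticChain μ γ).ringCurrent N θ x := by
  rw [pureQuarticChain_ringCurrent_eq, pureQuarticChain_ringCurrent_eq, mul_add, Finset.mul_sum]
  congr 1
  · exact Finset.sum_congr rfl fun i _ => pureQuarticChain_bondCurrent_quarticDilation μ γ a N i x
  · rw [Finset.mul_sum]
    refine Finset.sum_congr rfl fun i _ => ?_
    rw [Finset.mul_sum]
    refine Finset.sum_congr rfl fun j _ => ?_
    simp only [quarticDilation, Pi.smul_apply, smul_eq_mul]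
    split_ifs <;> ring

/-- **Mechanical similarity, forces**: the ring force of the purely quartic chain is homogeneous
of degree `3`, `F(a q) = a³ F(q)` (`a ≠ 0`; from `H_θ ∘ S_a = a⁴ H_θ` and the chain rule).
[cite: LandauLifshitzMechanics1976, §10] -/
theorem pureQuarticChain_ringForce_smul (μ γ θ : ℝ) {a : ℝ} (ha : a ≠ 0) (N : ℕ)
    (q : Fin N → ℝ) :
    (pureQuarticChain μ γ).ringForce N θ (a • q) =
      a ^ 3 • (pureQuarticChain μ γ).ringForce N θ q := by
  funext i
  simp only [OscillatorChain.ringForce, Pi.smul_apply, smul_eq_mul]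
  set H := (pureQuarticChain μ γ).ringHamiltonian N θ with hH
  have hfun : (fun y => H (quarticDilation a y)) = fun y => a ^ 4 * H y :=
    funext fun y => pureQuarticChain_ringHamiltonian_quarticDilation μ γ θ a N y
  have h1 := partialQ_comp_quarticDilation a i H (q, 0)
  rw [hfun, partialQ_const_mul_eq] at h1
  have hq : quarticDilation a ((q, 0) : PhaseSpace N) = (a • q, 0) := by
    simp [quarticDilation]
  rw [hq] at h1
  have key : a * partialQ i H (a • q, 0) = a * (a ^ 3 * partialQ i H (q, 0)) := by
    rw [← h1]; ring
  rw [mul_left_cancel₀ ha key]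
  ring

/-! ### Mechanical similarity of Newtonian flows with a cubic-homogeneous force -/

/-- `S_a` is continuous. [folklore] -/
theorem continuous_quarticDilation (a : ℝ) :
    Continuous fun x : PhaseSpace N => quarticDilation a x :=
  (continuous_fst.const_smul a).prodMk (continuous_snd.const_smul (a ^ 2))

/-- **Mechanical similarity, flows.** If `Φ` is a Newtonian flow (`NewtonianFlow.IsFlow`) of a
force field homogeneous of degree `3`, `F(a q) = a³ F(q)` (`a ≠ 0`), then the conjugated,
time-rescaled family `(t, x) ↦ S_a (Φ_{a t} (S_{a⁻¹} x))` is again a Newtonian flow of `F`: the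
trajectories of `H(a q, a² p) = a⁴ H(q, p)` are geometrically similar with times scaled by `a⁻¹`
(for a flow unique in its class this reads `Φ_t ∘ S_a = S_a ∘ Φ_{a t}`).
[cite: LandauLifshitzMechanics1976, §10] -/
theorem isFlow_conj_quarticDilation {F : (Fin N → ℝ) → (Fin N → ℝ)}
    {Φ : ℝ → PhaseSpace N → PhaseSpace N} (hΦ : NewtonianFlow.IsFlow F Φ) {a : ℝ} (ha : a ≠ 0)
    (hF : ∀ q, F (a • q) = a ^ 3 • F q) :
    NewtonianFlow.IsFlow F fun t x => quarticDilation a (Φ (a * t) (quarticDilation a⁻¹ x)) := by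
  refine ⟨?_, fun z => ?_, fun z t => ?_⟩
  · exact (continuous_quarticDilation a).comp (hΦ.1.comp
      ((continuous_const.mul continuous_fst).prodMk
        ((continuous_quarticDilation a⁻¹).comp continuous_snd)))
  · show quarticDilation a (Φ (a * 0) (quarticDilation a⁻¹ z)) = z
    rw [mul_zero, hΦ.2.1, ← quarticDilation_mul, mul_inv_cancel₀ ha, quarticDilation_one]
  · show HasDerivAt (fun s => quarticDilation a (Φ (a * s) (quarticDilation a⁻¹ z)))
      (NewtonianFlow.vectorField F (quarticDilation a (Φ (a * t) (quarticDilation a⁻¹ z)))) t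
    set z' := quarticDilation a⁻¹ z with hz'
    have hlin : HasDerivAt (fun s : ℝ => a * s) a t := by
      simpa using (hasDerivAt_id t).const_mul a
    have h1 : HasDerivAt (fun s => (Φ (a * s) z').1) (a • (Φ (a * t) z').2) t :=
      (hΦ.hasDerivAt_fst z' (a * t)).scomp_of_eq t hlin rfl
    have h2 : HasDerivAt (fun s => (Φ (a * s) z').2) (a • F (Φ (a * t) z').1) t :=
      (hΦ.hasDerivAt_snd z' (a * t)).scomp_of_eq t hlin rfl
    have h := (h1.fun_const_smul a).prodMk (h2.fun_const_smul (a ^ 2))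
    refine (h.congr_deriv ?_).congr_of_eventuallyEq (Filter.Eventually.of_forall fun s => rfl)
    rw [NewtonianFlow.vectorField, quarticDilation_snd, quarticDilation_fst, hF, smul_smul,
      smul_smul]
    refine Prod.ext ?_ ?_
    · show (a * a) • (Φ (a * t) z').2 = a ^ 2 • (Φ (a * t) z').2
      rw [sq]
    · show (a ^ 2 * a) • F (Φ (a * t) z').1 = a ^ 3 • F (Φ (a * t) z').1
      rw [← pow_succ]

/-- **Mechanical similarity of the purely quartic ring dynamics**: every Newtonian flow `Φ` of the
ring `H_θ` of `pureQuarticChain μ γ` yields the flow `S_a ∘ Φ_{a ·} ∘ S_{a⁻¹}` of the same ring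
(`a ≠ 0`). [cite: LandauLifshitzMechanics1976, §10] -/
theorem isFlow_pureQuarticChain_conj_quarticDilation (μ γ θ : ℝ) (N : ℕ)
    {Φ : ℝ → PhaseSpace N → PhaseSpace N}
    (hΦ : NewtonianFlow.IsFlow ((pureQuarticChain μ γ).ringForce N θ) Φ) {a : ℝ} (ha : a ≠ 0) :
    NewtonianFlow.IsFlow ((pureQuarticChain μ γ).ringForce N θ) fun t x =>
      quarticDilation a (Φ (a * t) (quarticDilation a⁻¹ x)) :=
  isFlow_conj_quarticDilation hΦ ha fun q => pureQuarticChain_ringForce_smul μ γ θ ha N q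

end Literature.MathematicalPhysics.KineticTheory.HeatConduction
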